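import Summits.HodgeConjecture.CorCM.IrreducibleOddWeightsMultiClassShadows
import HarnessLib

/-!
# The multiplicity formula across all isotypic classes, II: THE CLASS BLOCKS IN `ℚ^G` ARE INDEPENDENT —
# `⨆_s S(W_s) = ⨁_c ⨆_s S(p^s_c)` and `dim ⨆_s S(W_s) = Σ_c dim ⨆_s S(p^s_c)` for a whole family of slots

COR-CM (cell `pub-hodgecm2`, binder seat `b16` gen 75, count-neutral claim THE MULTIPLICITY FORMULA ACROSS ALL
ISOTYPIC CLASSES FOR A WHOLE FAMILY, file M2 — abstract `G`-set level; theorems only, no definition, no named fact,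
no `sorry`).  NEW as stated, hence under `Summits/`.  HONEST FRAMING: linear algebra of translates of functions on
finite `G`-sets (gen 70 I3 `…IsotypicContainers`, file M1 `…MultiClassShadows`); nothing about Hodge classes is
asserted, `HC_CM` is neither used nor asserted.

SETTING (file M1).  Reference irreducibles `A_c ≤ ℚ^{Y_c}` (`c ∈ C` finite), stable, irreducible, PAIRWISE
NON-ISOMORPHIC (`hsep`); the CONTAINER of class `c` is `𝒞_c = Σ_{y ∈ Y_c} Θ_y(A_c) ≤ ℚ^G`, `Θ_y a = (g ↦ a(g·y))`
(gen 70 I3).  A finite family of SLOTS `s ∈ S` with pivots `Y_s`; per slot and class, equivariant embeddings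
`ι^s_{c,j} : A_c → ℚ^{Y_s}` (`j ∈ J_{s,c}`) jointly independent on `A_c`, components `b^s_{c,j} ∈ A_c`, CLASS PARTS
`p^s_c = Σ_j ι^s_{c,j}(b^s_{c,j})`, SLOT VECTORS `W_s = Σ_c p^s_c`; `S(w) = span{g ↦ w(g·y)} ≤ ℚ^G`.

* §1 CONTAINER BOUNDS: `S(Σ_j w_j) ≤ ⨆_j S(w_j)`; **`S(θ a) ≤ 𝒞_A`** for `a ∈ A` and `θ` equivariant on `A`
  (`span_shadowCoeff_le_container_of_map`); `S(p^s_c) ≤ 𝒞_c`, `⨆_s S(p^s_c) ≤ 𝒞_c`.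
* §2 **THE CONTAINERS OF PAIRWISE NON-ISOMORPHIC REFERENCES ARE INDEPENDENT IN `ℚ^G`**
  (`iSupIndep_container_of_classes`): `ℚ^G` is the pivot `G` under left multiplication, the cells `Θ_y(A_c)` are
  left-stable irreducible (I3), a cell isomorphism across classes would embed `A_c ↪ A_{c′}` (I3
  `exists_map_of_cell_iso`), so I2/I4's cross-type independence applies to `𝒞_c` against `Σ_{c′≠c} 𝒞_{c′}`.
* §3 THE FAMILY SPLITS: **`⨆_s S(W_s) = ⨆_c ⨆_s S(p^s_c)`** (M1 slot by slot), the CLASS BLOCKS `⨆_s S(p^s_c) ≤ 𝒞_c`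
  are INDEPENDENT (`iSupIndep_iSup_span_shadowCoeff_of_classes`), hence
  **`dim ⨆_s S(W_s) = Σ_c dim ⨆_s S(p^s_c)`** (`finrank_iSup_span_shadowCoeff_eq_sum_of_classes`) and slot by slot
  `dim S(W_s) = Σ_c dim S(p^s_c)`; a lattice step `le_of_le_iSup_of_iSupIndep` (a subspace of `𝒞_c` below `⨆_{c′} U_{c′}`,
  `U_{c′} ≤ 𝒞_{c′}`, is below `U_c`) for the domination criteria of file M3.
Per class, gen 74 S3 (`…CommutantSigmaPivot`) then reads `dim(⨆_s S(p^s_c))·δ_c = dim(⨆_{s,j} D_c·b^s_{c,j})·dim A_c`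
(file M3 `…MultiClassDomination` assembles the counts).

## References

* [Serre1977] J.-P. Serre, *Linear Representations of Finite Groups*, GTM 42, §2.2 (Schur), §2.6 (canonical
  decomposition; isotypic components).
* [Lang2002] S. Lang, *Algebra*, 3rd ed., XVII §1 Prop. 1.1, XVII §2.
* [CurtisReiner1962] C. W. Curtis, I. Reiner, *Representation Theory of Finite Groups and Associative Algebras*, §27.
* [Gordon1999HodgeAVSurvey] B. B. Gordon, *A survey of the Hodge conjecture for abelian varieties*, §3 Theorem (proof),
  7.5–7.7.
-/

set_option autoImplicit false

noncomputable section

open scoped BigOperators Classical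

universe u uC uJ uS v v' vA vC w

namespace Summit.HodgeConjecture.CorCM.IrrOdd

open Literature.NumberTheory.ComplexMultiplication

variable {G : Type w} [Group G] {Y₀ : Type v'} [MulAction G Y₀]

/-! ### §1 Container bounds -/

/-- `S(Σ_{j∈s} w_j) ≤ ⨆_j S(w_j)` (each coefficient of a sum is the sum of the coefficients). [folklore] -/
theorem span_shadowCoeff_finset_sum_le_iSup {J : Type uJ} (w : J → (Y₀ → ℚ)) (s : Finset J) :
    Submodule.span ℚ (Set.range fun y : Y₀ => fun g : G => (∑ j ∈ s, w j) (g • y)) ≤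
      ⨆ j, Submodule.span ℚ (Set.range fun y : Y₀ => fun g : G => w j (g • y)) := by
  rw [Submodule.span_le]
  rintro _ ⟨y, rfl⟩
  have hsplit : (fun g : G => (∑ j ∈ s, w j) (g • y)) = ∑ j ∈ s, fun g : G => w j (g • y) := by
    funext g
    simp [Finset.sum_apply]
  change (fun g : G => (∑ j ∈ s, w j) (g • y)) ∈
    (⨆ j, Submodule.span ℚ (Set.range fun y : Y₀ => fun g : G => w j (g • y)) : Submodule ℚ (G → ℚ))
  rw [hsplit]
  exact Submodule.sum_mem _ fun j _ => Submodule.mem_iSup_of_mem j (Submodule.subset_span ⟨y, rfl⟩)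

/-- `S(Σ_j w_j) ≤ ⨆_j S(w_j)`. [folklore] -/
theorem span_shadowCoeff_sum_le_iSup {J : Type uJ} [Fintype J] (w : J → (Y₀ → ℚ)) :
    Submodule.span ℚ (Set.range fun y : Y₀ => fun g : G => (∑ j, w j) (g • y)) ≤
      ⨆ j, Submodule.span ℚ (Set.range fun y : Y₀ => fun g : G => w j (g • y)) :=
  span_shadowCoeff_finset_sum_le_iSup w Finset.univ

/-- **`S(θ a) ≤ 𝒞_A`**: the shadow-coefficient space of the image of `a ∈ A` under a linear `θ : ℚ^{Y_A} → ℚ^{Y₀}`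
equivariant on `A` lies in the container `Σ_y Θ_y(A)` of `A` (`S(θ a) ≤ S(a) ≤ 𝒞_A`, gen 69 Q3 §1 and gen 70 I3).
[cite: Serre1977, §2.6] [cite: Gordon1999HodgeAVSurvey, §3 Theorem (proof)] -/
theorem span_shadowCoeff_le_container_of_map {YA : Type vA} [MulAction G YA] [Fintype YA]
    {A : Submodule ℚ (YA → ℚ)} (θ : (YA → ℚ) →ₗ[ℚ] (Y₀ → ℚ))
    (hθeq : ∀ (k : G) (a : YA → ℚ), a ∈ A → θ (fun y => a (k • y)) = fun z => θ a (k • z))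
    {a : YA → ℚ} (ha : a ∈ A) :
    Submodule.span ℚ (Set.range fun y : Y₀ => fun g : G => θ a (g • y)) ≤
      ⨆ y : YA, A.map (LinearMap.funLeft ℚ ℚ (fun g : G => g • y)) :=
  (span_shadowCoeff_le_of_map θ (fun k => hθeq k a ha) rfl).trans (span_shadowCoeff_le_iSup_map_funLeft_orbit ha)

/-- **`S(Σ_j ι_j(b_j)) ≤ 𝒞_A`** for components `b_j ∈ A` and maps `ι_j` equivariant on `A`. [cite: Serre1977, §2.6] -/
theorem span_shadowCoeff_sum_le_container {YA : Type vA} [MulAction G YA] [Fintype YA]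
    {A : Submodule ℚ (YA → ℚ)} {J : Type uJ} [Fintype J] (ι : J → ((YA → ℚ) →ₗ[ℚ] (Y₀ → ℚ)))
    (hιeq : ∀ (j : J) (k : G) (a : YA → ℚ), a ∈ A → ι j (fun y => a (k • y)) = fun z => ι j a (k • z))
    {b : J → (YA → ℚ)} (hb : ∀ j, b j ∈ A) :
    Submodule.span ℚ (Set.range fun y : Y₀ => fun g : G => (∑ j, ι j (b j)) (g • y)) ≤
      ⨆ y : YA, A.map (LinearMap.funLeft ℚ ℚ (fun g : G => g • y)) :=
  (span_shadowCoeff_sum_le_iSup (fun j => ι j (b j))).trans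
    (iSup_le fun j => span_shadowCoeff_le_container_of_map (ι j) (hιeq j) (hb j))

/-! ### §2 The containers of pairwise non-isomorphic references are independent -/

section Classes

variable {C : Type uC} {Yc : C → Type vC} [∀ c, MulAction G (Yc c)] [∀ c, Fintype (Yc c)]
  {Ar : ∀ c, Submodule ℚ (Yc c → ℚ)}

/-- **THE CONTAINERS OF PAIRWISE NON-ISOMORPHIC REFERENCES ARE INDEPENDENT IN `ℚ^G`.**  `A_c ≤ ℚ^{Y_c}` stable
irreducible, pairwise non-isomorphic (`hsep`).  Then the containers **`𝒞_c = Σ_{y∈Y_c} Θ_y(A_c) ≤ ℚ^G` form an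
INDEPENDENT family**: the cells `Θ_y(A_c)` are stable irreducible for the left translations of `ℚ^G` (the pivot `G`
under left multiplication; gen 70 I3), and a cell isomorphism across two classes would give an equivariant embedding
`A_c ↪ A_{c′}` (I3 `exists_map_of_cell_iso`), excluded by `hsep`; so I4's cross-type independence applies to the cells
of class `c` against all cells of the other classes. [cite: Serre1977, §2.6] [cite: CurtisReiner1962, §27]
[cite: Lang2002, XVII §2] -/
theorem iSupIndep_container_of_classes [Fintype C]
    (hRst : ∀ c (k : G) (a : Yc c → ℚ), a ∈ Ar c → (fun y => a (k • y)) ∈ Ar c)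
    (hRirr : ∀ c (W : Submodule ℚ (Yc c → ℚ)), W ≤ Ar c → W ≠ ⊥ →
      (∀ (k : G) (f : Yc c → ℚ), f ∈ W → (fun y => f (k • y)) ∈ W) → W = Ar c)
    (hsep : ∀ c c' (L : (Yc c → ℚ) →ₗ[ℚ] (Yc c' → ℚ)), c ≠ c' → Ar c ≠ ⊥ → (∀ a ∈ Ar c, L a ∈ Ar c') →
      (∀ a ∈ Ar c, L a = 0 → a = 0) →
      (∀ (k : G) (a : Yc c → ℚ), a ∈ Ar c → L (fun y => a (k • y)) = fun y => L a (k • y)) → False) :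
    iSupIndep fun c => ⨆ y : Yc c, (Ar c).map (LinearMap.funLeft ℚ ℚ (fun g : G => g • y)) := by
  intro c
  rw [disjoint_iff]
  -- regroup the cells of the other classes as one family over a `Σ`-type
  have hle : (⨆ (c' : C) (_ : c' ≠ c), ⨆ y : Yc c', (Ar c').map (LinearMap.funLeft ℚ ℚ (fun g : G => g • y))) ≤
      ⨆ q : (Σ c' : {c' // c' ≠ c}, Yc c'.1),
        (Ar q.1.1).map (LinearMap.funLeft ℚ ℚ (fun g : G => g • q.2)) := by
    refine iSup₂_le fun c' hc' => iSup_le fun y => ?_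
    exact le_iSup (fun q : (Σ c' : {c' // c' ≠ c}, Yc c'.1) =>
      (Ar q.1.1).map (LinearMap.funLeft ℚ ℚ (fun g : G => g • q.2))) ⟨⟨c', hc'⟩, y⟩
  refine eq_bot_iff.2 (le_trans (inf_le_inf_left _ hle) (le_of_eq ?_))
  refine iSup_inf_iSup_eq_bot_of_forall_not_embed (G := G) (Y₀ := G)
    (A := fun y : Yc c => (Ar c).map (LinearMap.funLeft ℚ ℚ (fun g : G => g • y)))
    (B := fun q : (Σ c' : {c' // c' ≠ c}, Yc c'.1) =>
      (Ar q.1.1).map (LinearMap.funLeft ℚ ℚ (fun g : G => g • q.2)))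
    (fun y k v hv => map_funLeft_orbit_leftStable (hRst c) y k v hv)
    (fun y W hW hW0 hWst => map_funLeft_orbit_leftIrreducible (hRst c) (hRirr c) y W hW hW0 hWst)
    (fun q k v hv => map_funLeft_orbit_leftStable (hRst q.1.1) q.2 k v hv)
    (fun q W hW hW0 hWst => map_funLeft_orbit_leftIrreducible (hRst q.1.1) (hRirr q.1.1) q.2 W hW hW0 hWst) ?_
  intro y q L hne hL hLinj hLeq
  obtain ⟨L', hL'B, hL'inj, hL'eq⟩ := exists_map_of_cell_iso (hRst c) (hRirr c) (hRst q.1.1) (hRirr q.1.1) y q.2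
    hne L hL hLinj hLeq
  refine hsep c q.1.1 L' (fun h => q.1.2 h.symm) (fun h => hne ?_) hL'B hL'inj hL'eq
  rw [h, Submodule.map_bot]

omit [∀ c, MulAction G (Yc c)] [∀ c, Fintype (Yc c)] [MulAction G Y₀] [Group G] in
/-- The lattice step: `D_c` INDEPENDENT, `U_{c′} ≤ D_{c′}` for all `c′`, `X ≤ D_c` and `X ≤ ⨆_{c′} U_{c′}` ⟹ `X ≤ U_c`
(write `x = u + z` with `u ∈ U_c`, `z ∈ Σ_{c′≠c} U_{c′}`; then `z = x − u ∈ D_c ∩ Σ_{c′≠c} D_{c′} = 0`). [folklore] -/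
theorem le_of_le_iSup_of_iSupIndep {M : Type u} [AddCommGroup M] [Module ℚ M] {D U : C → Submodule ℚ M}
    (hD : iSupIndep D) (hU : ∀ c, U c ≤ D c) {X : Submodule ℚ M} {c : C} (hX : X ≤ D c) (hle : X ≤ ⨆ c', U c') :
    X ≤ U c := by
  intro x hx
  have hx' : x ∈ U c ⊔ ⨆ (c') (_ : c' ≠ c), U c' := by
    rw [← iSup_split_single U c]
    exact hle hx
  obtain ⟨u, hu, z, hz, rfl⟩ := Submodule.mem_sup.1 hx'
  have hzD : z ∈ D c := by
    have h := (D c).sub_mem (hX hx) (hU c hu)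
    rwa [add_sub_cancel_left] at h
  have hz' : z ∈ ⨆ (c') (_ : c' ≠ c), D c' :=
    (iSup₂_mono fun c' _ => hU c' : (⨆ (c') (_ : c' ≠ c), U c') ≤ ⨆ (c') (_ : c' ≠ c), D c') hz
  rw [(Submodule.disjoint_def.1 (hD c)) z hzD hz', add_zero]
  exact hu

/-! ### §3 The family splits over the classes -/

variable {S : Type uS} [Fintype S] {Yf : S → Type v} [∀ s, MulAction G (Yf s)] [∀ s, Fintype (Yf s)]
  {JJ : S → C → Type uJ} [∀ s c, Fintype (JJ s c)]

omit [Fintype S] in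
/-- **`⨆_s S(W_s) = ⨆_c ⨆_s S(p^s_c)`** for slot vectors `W_s = Σ_c p^s_c` assembled from pairwise non-isomorphic
references (file M1 slot by slot). [cite: Serre1977, §2.6] [cite: Gordon1999HodgeAVSurvey, §3 Theorem (proof)] -/
theorem iSup_span_shadowCoeff_sum_classes_eq_iSup [Fintype C]
    (hRst : ∀ c (k : G) (a : Yc c → ℚ), a ∈ Ar c → (fun y => a (k • y)) ∈ Ar c)
    (hRirr : ∀ c (W : Submodule ℚ (Yc c → ℚ)), W ≤ Ar c → W ≠ ⊥ →
      (∀ (k : G) (f : Yc c → ℚ), f ∈ W → (fun y => f (k • y)) ∈ W) → W = Ar c)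
    (hsep : ∀ c c' (L : (Yc c → ℚ) →ₗ[ℚ] (Yc c' → ℚ)), c ≠ c' → Ar c ≠ ⊥ → (∀ a ∈ Ar c, L a ∈ Ar c') →
      (∀ a ∈ Ar c, L a = 0 → a = 0) →
      (∀ (k : G) (a : Yc c → ℚ), a ∈ Ar c → L (fun y => a (k • y)) = fun y => L a (k • y)) → False)
    (ι : ∀ s c, JJ s c → ((Yc c → ℚ) →ₗ[ℚ] (Yf s → ℚ)))
    (hιeq : ∀ s c (j : JJ s c) (k : G) (a : Yc c → ℚ), a ∈ Ar c →
      ι s c j (fun y => a (k • y)) = fun y => ι s c j a (k • y))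
    (hind : ∀ s c (f : JJ s c → (Yc c → ℚ)), (∀ j, f j ∈ Ar c) → ∑ j, ι s c j (f j) = 0 → ∀ j, f j = 0)
    {b : ∀ s c, JJ s c → (Yc c → ℚ)} (hb : ∀ s c j, b s c j ∈ Ar c) :
    (⨆ s, Submodule.span ℚ (Set.range fun y : Yf s => fun g : G => (∑ c, ∑ j, ι s c j (b s c j)) (g • y))) =
      ⨆ c, ⨆ s, Submodule.span ℚ (Set.range fun y : Yf s => fun g : G => (∑ j, ι s c j (b s c j)) (g • y)) := by
  rw [iSup_comm]
  exact iSup_congr fun s => span_shadowCoeff_sum_classes_eq_iSup hRst hRirr hsep (ι s) (hιeq s) (hind s) (hb s)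

omit [Fintype S] [∀ s, Fintype (Yf s)] in
/-- The class block `⨆_s S(p^s_c)` lies in the container `𝒞_c`. [cite: Serre1977, §2.6] -/
theorem iSup_span_shadowCoeff_le_container (c : C) (ι : ∀ s c, JJ s c → ((Yc c → ℚ) →ₗ[ℚ] (Yf s → ℚ)))
    (hιeq : ∀ s c (j : JJ s c) (k : G) (a : Yc c → ℚ), a ∈ Ar c →
      ι s c j (fun y => a (k • y)) = fun y => ι s c j a (k • y))
    {b : ∀ s c, JJ s c → (Yc c → ℚ)} (hb : ∀ s c j, b s c j ∈ Ar c) :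
    (⨆ s, Submodule.span ℚ (Set.range fun y : Yf s => fun g : G => (∑ j, ι s c j (b s c j)) (g • y))) ≤
      ⨆ y : Yc c, (Ar c).map (LinearMap.funLeft ℚ ℚ (fun g : G => g • y)) :=
  iSup_le fun s => span_shadowCoeff_sum_le_container (ι s c) (hιeq s c) (hb s c)

omit [Fintype S] [∀ s, Fintype (Yf s)] in
/-- **THE CLASS BLOCKS ARE INDEPENDENT**: the subspaces `⨆_s S(p^s_c) ≤ ℚ^G` (`c ∈ C`) form an independent family
(each lies in its container, §2). [cite: Serre1977, §2.6] [cite: Lang2002, XVII §2] -/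
theorem iSupIndep_iSup_span_shadowCoeff_of_classes [Fintype C]
    (hRst : ∀ c (k : G) (a : Yc c → ℚ), a ∈ Ar c → (fun y => a (k • y)) ∈ Ar c)
    (hRirr : ∀ c (W : Submodule ℚ (Yc c → ℚ)), W ≤ Ar c → W ≠ ⊥ →
      (∀ (k : G) (f : Yc c → ℚ), f ∈ W → (fun y => f (k • y)) ∈ W) → W = Ar c)
    (hsep : ∀ c c' (L : (Yc c → ℚ) →ₗ[ℚ] (Yc c' → ℚ)), c ≠ c' → Ar c ≠ ⊥ → (∀ a ∈ Ar c, L a ∈ Ar c') →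
      (∀ a ∈ Ar c, L a = 0 → a = 0) →
      (∀ (k : G) (a : Yc c → ℚ), a ∈ Ar c → L (fun y => a (k • y)) = fun y => L a (k • y)) → False)
    (ι : ∀ s c, JJ s c → ((Yc c → ℚ) →ₗ[ℚ] (Yf s → ℚ)))
    (hιeq : ∀ s c (j : JJ s c) (k : G) (a : Yc c → ℚ), a ∈ Ar c →
      ι s c j (fun y => a (k • y)) = fun y => ι s c j a (k • y))
    {b : ∀ s c, JJ s c → (Yc c → ℚ)} (hb : ∀ s c j, b s c j ∈ Ar c) :
    iSupIndep fun c => ⨆ s, Submodule.span ℚ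
      (Set.range fun y : Yf s => fun g : G => (∑ j, ι s c j (b s c j)) (g • y)) :=
  (iSupIndep_container_of_classes hRst hRirr hsep).mono fun c => iSup_span_shadowCoeff_le_container c ι hιeq hb

/-- **`dim ⨆_s S(W_s) = Σ_c dim ⨆_s S(p^s_c)`** — the coefficient space of the whole family is the DIRECT sum of its
class blocks. [cite: Serre1977, §2.6] [cite: Gordon1999HodgeAVSurvey, §3 Theorem (proof), 7.5–7.7] -/
theorem finrank_iSup_span_shadowCoeff_eq_sum_of_classes [Fintype C]
    (hRst : ∀ c (k : G) (a : Yc c → ℚ), a ∈ Ar c → (fun y => a (k • y)) ∈ Ar c)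
    (hRirr : ∀ c (W : Submodule ℚ (Yc c → ℚ)), W ≤ Ar c → W ≠ ⊥ →
      (∀ (k : G) (f : Yc c → ℚ), f ∈ W → (fun y => f (k • y)) ∈ W) → W = Ar c)
    (hsep : ∀ c c' (L : (Yc c → ℚ) →ₗ[ℚ] (Yc c' → ℚ)), c ≠ c' → Ar c ≠ ⊥ → (∀ a ∈ Ar c, L a ∈ Ar c') →
      (∀ a ∈ Ar c, L a = 0 → a = 0) →
      (∀ (k : G) (a : Yc c → ℚ), a ∈ Ar c → L (fun y => a (k • y)) = fun y => L a (k • y)) → False)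
    (ι : ∀ s c, JJ s c → ((Yc c → ℚ) →ₗ[ℚ] (Yf s → ℚ)))
    (hιeq : ∀ s c (j : JJ s c) (k : G) (a : Yc c → ℚ), a ∈ Ar c →
      ι s c j (fun y => a (k • y)) = fun y => ι s c j a (k • y))
    (hind : ∀ s c (f : JJ s c → (Yc c → ℚ)), (∀ j, f j ∈ Ar c) → ∑ j, ι s c j (f j) = 0 → ∀ j, f j = 0)
    {b : ∀ s c, JJ s c → (Yc c → ℚ)} (hb : ∀ s c j, b s c j ∈ Ar c) :
    Module.finrank ℚ
        ↥(⨆ s, Submodule.span ℚ (Set.range fun y : Yf s => fun g : G => (∑ c, ∑ j, ι s c j (b s c j)) (g • y))) =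
      ∑ c, Module.finrank ℚ
        ↥(⨆ s, Submodule.span ℚ (Set.range fun y : Yf s => fun g : G => (∑ j, ι s c j (b s c j)) (g • y))) := by
  haveI : ∀ s c, Module.Finite ℚ
      ↥(Submodule.span ℚ (Set.range fun y : Yf s => fun g : G => (∑ j, ι s c j (b s c j)) (g • y))) :=
    fun s c => Module.Finite.span_of_finite ℚ (Set.finite_range _)
  haveI : ∀ c, Module.Finite ℚ ↥(⨆ s, Submodule.span ℚ
      (Set.range fun y : Yf s => fun g : G => (∑ j, ι s c j (b s c j)) (g • y))) := fun c =>
    Submodule.finite_iSup _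
  rw [iSup_span_shadowCoeff_sum_classes_eq_iSup hRst hRirr hsep ι hιeq hind hb,
    finrank_iSup_eq_sum_finrank_iff_iSupIndep]
  exact iSupIndep_iSup_span_shadowCoeff_of_classes hRst hRirr hsep ι hιeq hb

omit [Fintype S] [∀ s, Fintype (Yf s)] [∀ s, MulAction G (Yf s)] in
/-- **ONE SLOT: `dim S(W) = Σ_c dim S(p_c)`** — the class parts of one vector have INDEPENDENT shadow-coefficient
spaces. [cite: Serre1977, §2.6] [cite: Gordon1999HodgeAVSurvey, §3 Theorem (proof), 7.5–7.7] -/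
theorem finrank_span_shadowCoeff_eq_sum_of_classes [Fintype C] [Fintype Y₀]
    (hRst : ∀ c (k : G) (a : Yc c → ℚ), a ∈ Ar c → (fun y => a (k • y)) ∈ Ar c)
    (hRirr : ∀ c (W : Submodule ℚ (Yc c → ℚ)), W ≤ Ar c → W ≠ ⊥ →
      (∀ (k : G) (f : Yc c → ℚ), f ∈ W → (fun y => f (k • y)) ∈ W) → W = Ar c)
    (hsep : ∀ c c' (L : (Yc c → ℚ) →ₗ[ℚ] (Yc c' → ℚ)), c ≠ c' → Ar c ≠ ⊥ → (∀ a ∈ Ar c, L a ∈ Ar c') →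
      (∀ a ∈ Ar c, L a = 0 → a = 0) →
      (∀ (k : G) (a : Yc c → ℚ), a ∈ Ar c → L (fun y => a (k • y)) = fun y => L a (k • y)) → False)
    {J₀ : C → Type uJ} [∀ c, Fintype (J₀ c)] (ι : ∀ c, J₀ c → ((Yc c → ℚ) →ₗ[ℚ] (Y₀ → ℚ)))
    (hιeq : ∀ c (j : J₀ c) (k : G) (a : Yc c → ℚ), a ∈ Ar c →
      ι c j (fun y => a (k • y)) = fun y => ι c j a (k • y))
    (hind : ∀ c (f : J₀ c → (Yc c → ℚ)), (∀ j, f j ∈ Ar c) → ∑ j, ι c j (f j) = 0 → ∀ j, f j = 0)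
    {b : ∀ c, J₀ c → (Yc c → ℚ)} (hb : ∀ c j, b c j ∈ Ar c) :
    Module.finrank ℚ
        ↥(Submodule.span ℚ (Set.range fun y : Y₀ => fun g : G => (∑ c, ∑ j, ι c j (b c j)) (g • y))) =
      ∑ c, Module.finrank ℚ
        ↥(Submodule.span ℚ (Set.range fun y : Y₀ => fun g : G => (∑ j, ι c j (b c j)) (g • y))) := by
  haveI : ∀ c, Module.Finite ℚ
      ↥(Submodule.span ℚ (Set.range fun y : Y₀ => fun g : G => (∑ j, ι c j (b c j)) (g • y))) := fun c =>
    Module.Finite.span_of_finite ℚ (Set.finite_range _)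
  rw [span_shadowCoeff_sum_classes_eq_iSup hRst hRirr hsep ι hιeq hind hb, finrank_iSup_eq_sum_finrank_iff_iSupIndep]
  exact (iSupIndep_container_of_classes hRst hRirr hsep).mono fun c =>
    span_shadowCoeff_sum_le_container (ι c) (hιeq c) (hb c)

end Classes

end Summit.HodgeConjecture.CorCM.IrrOdd

end
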